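import Literature.Combinatorics.Optimization.EquivariantPsdFactorization
import Literature.Combinatorics.Optimization.MatchingFunctionDegree
import HarnessLib
import HarnessLib.Audit

/-!
# Typed obligation of cell pnp-psdrank (D-0047): small `S_n`-invariant spaces of functions on perfect matchings
# have low matching-degree — the ONE open statement of the rung route `EquivariantThetaLift` (rung F-N2/R2)

This file ASSERTS NOTHING: it defines one statement (`def … : Prop`, tagged `@[conjecture]` = an obligation
node of OUR theories, NOT a published theorem) with an unfolding `example`. It is the single open crux
`InvariantSubspaceLowDegree` of the rung route `EquivariantThetaLift` (HOME/pnp-psdrank-p2/route-R2*/,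
typed by pnp-psdrank-p2): every `S_n`-invariant subspace `V` of real functions on the perfect matchings of
`K_n` with `dim V < 2^k` (`n` even, `4k + 2 ≤ n`) is contained in `Pol_{≤ k}` = the span of the indicators
`[Q ⊆ M]`, `|Q| ≤ k` (`Literature.Combinatorics.Optimization.polLE`). Everything else on that route is PROVED in
the tree (`IsEquivariantPsdFactorization.exists_invariant_sos_subspace`, `Mod2.matchingEffectiveDerivationV`,
`Grigoriev2001_mod2Degree_holds`), so the rung `Summit.PneNP.MatchingPsdRank.MatchingEquivariantPsdBound` is a
CONDITIONAL BRIDGE from this statement; the gate's crux floor (≥ 2 cruxes) admits one-statement rung routes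
only in that shape (abc-stewartyu precedent 2026-08-25T21:1xZ; 21-frontier ruling 2026-08-25T20:00Z), which is
why the statement is recorded here as a decl.

STATUS 2026-08-25T21:17Z: PROVED in the cell prover's seat (`Literature.Combinatorics.Optimization.invariantSubspaceLowDegree`,
file `MatchingInvariantSubspaces.lean`, proposal p408274 pending on farm olean lag; end-to-end rung composition `all_rung.lean` farm rc 0,
0 sorries, axioms standard — HOME/pnp-psdrank-prover/MEMO-2.md); this decl is discharged the moment that theorem lands.
WHY IT HOLDS (the proof's inputs, all in the tree or landing: `Literature/Combinatorics/Optimization/MatchingJunta.lean`,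
`Literature/RepresentationTheory/FiniteGroups/FourierVanishingSmallDim.lean`, `…/FourierVanishingPairStabilizer.lean`,
cell prover 2026-08-25): `ℝ^{PM(K_{2m})} = ⊕_{λ ⊢ m} S^{2λ}` is multiplicity-free (Thrall; Saxl) and the
degree filtration is `Pol_{≤ d} = ⊕_{λ₁ ≥ m − d} S^{2λ}` [cite: DafniEtAl2020, Thm. 5.7 (p. 21)]
(= Lindzey's thesis Thm. 5.2.7); an invariant `V` is the sum of the `S^{2λ}` it meets, each of dimension
`f^{2λ} ≤ dim V < 2^k`, and the hook-length dichotomy `Literature.NumberTheory.DiophantineGeometry.spechtDimDichotomy`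
(in the tree, `t = 2k`; the transposed branch is void because `ℓ(λ) ≤ m ≤ 2m − 2k`) forces `2λ₁ ≥ 2m − 2k + 1`,
i.e. `λ₁ ≥ m − k + 1`, i.e. degree `≤ k − 1 ≤ k`. Elementary variant (the prover's line): Fourier support of the
pull-back to `S_n` (Ellis–Friedgut–Pilpel) + relative transitivity ⇒ `(2k−1)`-juntas ⇒ `mem_polLE_of_invariant`.
WHAT THIS IS NOT: not a published theorem as stated (a consequence of published results plus the in-tree
dichotomy); nothing here is a claim on P vs NP; the rung it feeds is SYMMETRIC strength only.
-/

noncomputable section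

namespace Summit.PneNP.MatchingPsdRank

open Literature.Combinatorics.Optimization

/-- **Small invariant subspaces of matching functions have low degree.** For even `n ≥ 4k + 2`, every
`S_n`-invariant subspace `V ≤ ℝ^{PM(K_n)}` (`IsPermInvariant`: closed under `f ↦ f(σ⁻¹ • ·)`) with
`dim V < 2^k` is contained in `polLE n k`. Token-for-token the route item
`Summit.PneNP.PneNP.Theses.EquivariantThetaLift.InvariantSubspaceLowDegree`. Not in print as stated; follows from
[cite: DafniEtAl2020, Thm. 5.7 (p. 21)] with the in-tree `spechtDimDichotomy`. -/
@[conjecture]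
def InvariantSubspaceLowDegree : Prop :=
  ∀ n k : ℕ, Even n → 4 * k + 2 ≤ n → ∀ V : Submodule ℝ (PMSol n → ℝ),
    IsPermInvariant V → Module.finrank ℝ V < 2 ^ k → V ≤ polLE n k

/-- Unfolding (the statement is exactly the displayed formula, over the Literature vocabulary). -/
example : InvariantSubspaceLowDegree ↔
    ∀ n k : ℕ, Even n → 4 * k + 2 ≤ n → ∀ V : Submodule ℝ (Literature.Combinatorics.Optimization.PMSol n → ℝ),
      Literature.Combinatorics.Optimization.IsPermInvariant V → Module.finrank ℝ V < 2 ^ k →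
        V ≤ Literature.Combinatorics.Optimization.polLE n k :=
  Iff.rfl

end Summit.PneNP.MatchingPsdRank

end
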